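import Mathlib.AlgebraicGeometry.ProjectiveSpectrum.Proper
import Mathlib.RingTheory.MvPolynomial.Homogeneous
import Mathlib.AlgebraicGeometry.Morphisms.Smooth
import Mathlib.AlgebraicGeometry.Morphisms.ClosedImmersion
import Mathlib.AlgebraicGeometry.Morphisms.Proper
import Mathlib.AlgebraicGeometry.Geometrically.Irreducible
import Mathlib.AlgebraicGeometry.Geometrically.Integral
import Mathlib.AlgebraicGeometry.Pullbacks
import Mathlib.AlgebraicGeometry.Noetherian
import Mathlib.CategoryTheory.Comma.Over.Pullback
import Mathlib.Topology.KrullDimension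
import Mathlib.Order.KrullDimension
import Summits.Ventures.HodgeRepro2.HostAPI.Util.ForallBinderLint

universe u

open CategoryTheory AlgebraicGeometry MonoidalCategory

namespace HostAPI.Carriers.AlgebraicGeometry.Motives

abbrev SchemeOver (k : Type u) [CommRing k] : Type (u + 1) :=
  Over (Spec (CommRingCat.of k))

section Base

variable (k : Type u) [CommRing k] (L : Type u) [CommRing L] [Algebra k L]

noncomputable abbrev specOver : SchemeOver k :=
  Over.mk (Spec.map (CommRingCat.ofHom (algebraMap k L)))

noncomputable def baseChange : SchemeOver k ⥤ SchemeOver L :=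
  Over.pullback (Spec.map (CommRingCat.ofHom (algebraMap k L)))

end Base

section Projective

variable (n : ℕ) (k : Type u) [Field k]

noncomputable def projectiveSpace : SchemeOver k :=
  letI := MvPolynomial.gradedAlgebra (σ := Fin (n + 1)) (R := k)
  Over.mk (Proj.toSpecZero (MvPolynomial.homogeneousSubmodule (Fin (n + 1)) k) ≫
    Spec.map (CommRingCat.ofHom
      (algebraMap k (MvPolynomial.homogeneousSubmodule (Fin (n + 1)) k 0))))

variable {k}

def IsProjectiveOver (X : SchemeOver k) : Prop :=
  ∃ (n : ℕ) (ι : X ⟶ projectiveSpace n k), IsClosedImmersion ι.left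

structure ProjectiveEmbedding (X : SchemeOver k) where

  n : ℕ

  ι : X ⟶ projectiveSpace n k

  isClosedImmersion : IsClosedImmersion ι.left

attribute [instance] ProjectiveEmbedding.isClosedImmersion

theorem ProjectiveEmbedding.isProjectiveOver {X : SchemeOver k} (e : ProjectiveEmbedding X) :
    IsProjectiveOver X :=
  ⟨e.n, e.ι, e.isClosedImmersion⟩

noncomputable def IsProjectiveOver.projectiveEmbedding {X : SchemeOver k}
    (h : IsProjectiveOver X) : ProjectiveEmbedding X :=
  ⟨h.choose, h.choose_spec.choose, h.choose_spec.choose_spec⟩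

structure IsSmoothProjective (n : ℕ) (X : SchemeOver k) : Prop where

  smoothOfRelativeDimension : SmoothOfRelativeDimension n X.hom

  isProjectiveOver : IsProjectiveOver X

  geometricallyIrreducible : GeometricallyIrreducible X.hom

end Projective

noncomputable def schemeDim (X : Scheme.{u}) : ℕ :=
  ((topologicalKrullDim X).unbotD 0).toNat

section API

variable {k : Type u} [Field k] {n m : ℕ} {X Y : SchemeOver k}

def schemeDim_eq : Prop :=
  ∀ (h : IsSmoothProjective n X),
    schemeDim X.left = n

namespace IsSmoothProjective

def isProper : Prop :=
  ∀ (h : IsSmoothProjective n X),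
    IsProper X.hom

def geometricallyIntegral : Prop :=
  ∀ (h : IsSmoothProjective n X),
    GeometricallyIntegral X.hom

def isIntegral : Prop :=
  ∀ (h : IsSmoothProjective n X),
    IsIntegral X.left

def quasiCompact : Prop :=
  ∀ (h : IsSmoothProjective n X),
    QuasiCompact X.hom

def compactSpace : Prop :=
  ∀ (h : IsSmoothProjective n X),
    CompactSpace X.left

def isLocallyNoetherian : Prop :=
  ∀ (h : IsSmoothProjective n X),
    IsLocallyNoetherian X.left

theorem isLocallyNoetherian_holds : isLocallyNoetherian (n := n) (X := X) := by
  intro h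
  have := h.smoothOfRelativeDimension
  have : Smooth X.hom := SmoothOfRelativeDimension.smooth n X.hom
  exact LocallyOfFiniteType.isLocallyNoetherian X.hom

def tensor : Prop :=
  ∀ (hX : IsSmoothProjective n X) (hY : IsSmoothProjective m Y),
    IsSmoothProjective (n + m) (X ⊗ Y)

end IsSmoothProjective

def IsSmoothProjective.baseChange : Prop :=
  ∀ (L : Type u) [Field L] [Algebra k L] (hX : IsSmoothProjective n X),
    IsSmoothProjective n ((HostAPI.Carriers.AlgebraicGeometry.Motives.baseChange k L).obj X)

variable (n k)

def isSmoothProjective_projectiveSpace : Prop :=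
  IsSmoothProjective n (projectiveSpace n k)

def isSmoothProjective_unit : Prop :=
  IsSmoothProjective 0 (𝟙_ (SchemeOver k))

def exists_coheight_eq_one_projectiveSpace : Prop :=
  ∀ (hn : 1 ≤ n),
    ∃ x : ↥(projectiveSpace n k).left, Order.coheight x = 1

end API

end HostAPI.Carriers.AlgebraicGeometry.Motives
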